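import Literature.Geometry.Lorentzian.KerrFluxComparison
import Literature.Geometry.Lorentzian.Geodesic
import HarnessLib

/-!
# Trapped null geodesics of the Kerr exterior with `N`-energy bounded away from `0` and `∞`
# (Sbierski 2015, §7A), and the `N`-energy in a volume (§1E): the geometric input of the trapping
# obstruction, as a named fact (proved in `KerrPhotonOrbit.lean`)
(family `gr`; infrastructure under the barrier `Literature.Barriers.FinalStateConjecture.
SbierskiTrappingObstruction` / `SbierskiKerrTrappingLED`; namespace
`Literature.Geometry.Lorentzian`, grouping sub-namespace `Kerr` for the Kerr–Schild objects)

Sbierski (Anal. PDE 8 (2015) 1379–1420) proves that trapping on the Kerr exterior rules out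
local energy decay in terms of the first-order energy (Thm. 7.4) by "invoking Theorem 5.5", whose
four-line proof draws its contradiction from **two inputs**:

1. **Thm. 5.1** (solutions of `□_g v = 0` in the Gaussian-beam limit): on a time-oriented globally
   hyperbolic `(M, g)` with time function `t`, `Σ_τ = {t = τ}`, `Σ₀` Cauchy, for an affinely
   parametrised future-directed null geodesic `γ : [0, S) → M` with `γ(0) ∈ Σ₀` and a timelike
   future-directed `N`: "For any neighbourhood `𝒩` of `γ`, any `T > 0` with `Σ_T ∩ Im(γ) ≠ ∅`,
   and any `μ > 0`, there exists a solution `v ∈ C^∞(M, ℂ)` of the wave equation with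
   `E^N_0(v) = −g(N, γ̇)|_{γ(0)}` such that `|E^N_{τ, 𝒩 ∩ Σ_τ}(v) − [−g(N, γ̇)|_{Im γ ∩ Σ_τ}]| < μ`
   for all `0 ≤ τ ≤ T`" (pp. 1396–1397), which "follows easily from Theorem 2.1 [the Cauchy
   problem with the energy estimate, given the Gaussian beams of §3], Theorem 4.1 [the
   characterisation of the energy of Gaussian beams] […] and the triangle inequality for the
   square root of the `N`-energy" (its proof) — two existence theories for linear waves on
   Lorentzian manifolds that neither Mathlib nor `Literature/` has (the only solutions of
   `□_g ψ = 0` in the tree are constants, `dalembertian_const`).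
2. **§7A** (trapping in (sub)extremal Kerr, `0 ≤ a ≤ m`, `m ≠ 0`, pp. 1412–1414): the domain of
   outer communications is foliated by `Σ_τ = {t* = τ}`, `t* = v₊ − r`, with `N = −(dt*)♯`; "there
   are trapped null geodesics in the domain of outer communications of the Kerr spacetime whose
   energy stays bounded away from zero and infinity", namely the null geodesics `γ_{r₀}` of
   constant `r = r₀`, `r₀ ∈ [r_δ, r_ρ]` (`r_δ, r_ρ` the roots `≥ r₊` of `r(r − 3m)² − 4a²m`), for
   which "`−(N, γ̇) = (dt + dr* − dr)(γ̇) = ṫ`" is bounded away from `0` and `∞` (O'Neill 1995,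
   Ch. 4; Chandrasekhar, §63(c)).

This file vendors **input 2** as the named fact `Sbierski2015_kerr_trappedNullGeodesic` (D-0014),
specialised — exactly as the paper specialises it in §7A/Thm. 7.4 — to the ingoing Kerr–Schild
exterior chart of the prelude: the trapped null geodesic of §7A with the printed bounds on its
`N`-energy `γ̇⁰` (`−g(N, γ̇) = γ̇⁰` for `N = V = Kerr.timeVector = −g♯(dt*)`,
`Kerr.bilin_timeVector`), as a geodesic (`IsGeodesic`) of the Levi-Civita connection of
`Kerr.smoothMetric M a r₊` with null velocity (`LorentzianMetric.IsNull`). It is **proved** in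
`KerrPhotonOrbit.lean` (`Sbierski2015_kerr_trappedNullGeodesic_holds`: the explicit retrograde
equatorial circular photon orbit, via the chart form of the geodesic equation
`OpensChart.isGeodesic_of_hasDerivAt`). Alongside it, the small vocabulary of Sbierski's energies
in the prelude's currency: `Kerr.setLeafFlux` — the `N`-energy through `Σ_τ` restricted to a set
`A` of spatial coordinates, `E^N_{τ, A}` of §1E (1.9) (the integral over `A` of the tree's flux
density `Kerr.leafFluxDensity M a 0`, which is `J^V_μ n^μ dσ/dy` on the Kerr–Schild slice;
`A = univ` is `Kerr.leafFlux`, `A` the closed coordinate ball is `Kerr.localLeafFlux`);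
`Kerr.timeSection` — the time-`τ` section `𝒩 ∩ Σ_τ` of a subset `𝒩` of the chart, read in the
coordinates of the slice (the sets of Thm. 5.1); and `Kerr.spatialNorm_le_of_radius_eq` — an
orbit `{r = r₀}` lies in the coordinate ball `{‖y‖ ≤ r₀ + |a|}` (from the tree's
`Kerr.spatialNorm_sq_sub_sq_le_radius_sq`).

**Input 1 is not vendored here** (D-0026). Thm. 5.1 on the Kerr exterior is, by its printed proof,
the conjunction — up to Thm. 2.1's approximation argument — of the paper's two hard inputs, each of
which the tree vendors once as a canonical named fact: the Cauchy problem for `□_g`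
(`KerrSchild.waveCauchyProblem`, `KerrSchildWaveCauchyProblem.lean`: Bär–Ginoux–Pfäffle 2007,
Thm. 3.2.11, on generalised Kerr–Schild backgrounds over `ℝ⁴`, into which the exterior embeds by
metric surgery; the energy estimate of the proof of Thm. 2.1 is *proved* from it,
`Literature.Barriers.FinalStateConjecture.kerr_localEnergyEstimate_of_waveCauchyProblem`) and the
Gaussian beams of §3–§4 along a given null geodesic of the exterior
(`Literature.Barriers.FinalStateConjecture.KerrNullGeodesicGaussianBeams`,
`TrappingDerivativeLossGeodesicBeams.lean`, with the same hypotheses on `γ` as below). The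
barrier follows from that pair, the geodesic of this file entering as a theorem:
`Literature.Barriers.FinalStateConjecture.SbierskiKerrTrappingLED.of_waveCauchyProblem_of_nullGeodesicBeams`
(`TrappingDerivativeLossOrbit.lean`, through `SbierskiKerrTrappedGeodesicBeams.of_nullGeodesicBeams'`,
Thm. 2.1's argument `SbierskiKerrLocalisedSolutions.of_waveCauchyProblem` and Thm. 5.5's argument
`SbierskiTrappingObstruction.of_localisedSolutions`). An earlier version of this file (p21141)
also carried Thm. 5.1 itself, specialised to Kerr, as a named fact
(`Sbierski2015_kerr_beamSolutions`); being theory-sized twice over and a coarser duplicate of the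
canonical pair as a leaf of the trust base, it was merged back under the D-0026 review of
decomposition children and retired.

## Rendering choices (all on the side of a WEAKER vendored statement)

* In `Sbierski2015_kerr_trappedNullGeodesic` the geodesic is *asserted* on all of `ℝ`
  (past-complete as well), which goes beyond the quoted sentence of §7A ("a future, complete,
  affinely parametrised null geodesic `γ : [0, ∞) → M`") but holds for the constant-`r` orbits
  (they are invariant under `t ↦ −t`, `φ ↦ −φ`; O'Neill 1995, Ch. 4) and is proved in
  `KerrPhotonOrbit.lean`; likewise the continuity, strict monotonicity and divergence of `t* ∘ γ`
  recorded there are consequences of the other clauses, kept for the consumers (the beams along a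
  given geodesic need `t*(γ 0) = 0`, `t* ∘ γ` strictly increasing and every leaf `Σ_τ`, `τ ≥ 0`,
  crossed).
* The strict extremal case `r₀ = r_δ = r₊ = m` of the printed interval `[r_δ, r_ρ]` is excluded by
  `r₀ > r₊` (the chart is the open exterior); `r₀ = r_ρ` is always available.

## References

* J. Sbierski, Anal. PDE 8 (2015) 1379–1420 (doi:10.2140/apde.2015.8.1379, arXiv:1311.2477):
  §1E (1.9) (`E^N_{τ, A}`), Thm. 2.1 and its proof (p. 1388), Thm. 4.1, Thm. 5.1 and its proof
  (pp. 1396–1397), Thm. 5.5 (p. 1397), §7A (pp. 1412–1414), Thm. 7.4 (pp. 1414–1415)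
  (key `Sbierski2015`; theorem numbers of the journal version).
* B. O'Neill, *The geometry of Kerr black holes*, A K Peters 1995, Ch. 4 (key `ONeill1995`).
* M. Dafermos, I. Rodnianski, Y. Shlapentokh-Rothman, Ann. of Math. 183 (2016), §3.1 (the
  comparability `∫_Σ J^N_μ n^μ ∼ ∫ |∂ψ|²`) (key `DafermosRodnianskiShlapentokhrothman2014`).
-/

noncomputable section

open Set Filter MeasureTheory
open scoped Manifold ContDiff Topology ENNReal

namespace Literature.Geometry.Lorentzian

namespace Kerr

/-! ### Orbits of constant `r` lie in coordinate balls -/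

/-- On an orbit of constant Kerr–Schild radius `r = r₀` the spatial coordinate norm is at most
`r₀ + |a|`: `‖x⃗‖² − a² ≤ r²` (the tree's `Kerr.spatialNorm_sq_sub_sq_le_radius_sq`; the level sets
`{r = c}` are the confocal ellipsoids `(x² + y²)/(c² + a²) + z²/c² = 1`, O'Neill 1995, Ch. 2,
§2.1). [folklore] -/
theorem spatialNorm_le_of_radius_eq {a r₀ : ℝ} {x : E4} (hr₀ : 0 < r₀) (hx : radius a x = r₀) :
    E4.spatialNorm x ≤ r₀ + |a| := by
  have h := spatialNorm_sq_sub_sq_le_radius_sq a x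
  rw [hx] at h
  have h0 : 0 ≤ E4.spatialNorm x := E4.spatialNorm_nonneg x
  have ha : 0 ≤ |a| := abs_nonneg a
  nlinarith [sq_abs a, h0, ha]

/-! ### The `V`-energy through a Kerr–Schild slice restricted to a set -/

/-- The **`N`-energy of `ψ` at time `τ` in the volume `A`** for `N = V = −g♯(dt*)` and the
Kerr–Schild slice `Σ_τ = {t* = τ}` of the exterior: `E^V_{τ, A}(ψ) = ∫_{y ∈ A} T[ψ](V, V)(τ, y) dy
= ∫_{Σ_τ ∩ A} J^V_μ n^μ dσ` (the flux density `Kerr.leafFluxDensity M a 0` is `J^V_μ n^μ dσ/dy`,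
`KerrHyperboloidalFlux.lean`), for an arbitrary set `A ⊆ E3` of spatial coordinates. Sbierski,
Anal. PDE 8 (2015), §1E, (1.9) ("`E^N_{τ, A}(u)` denotes the `N`-energy of `u` at time `τ` in
the volume `A`"). `A = univ` is `Kerr.leafFlux M a 0`, `A = {‖y‖ ≤ R}` is `Kerr.localLeafFlux`.
[cite: Sbierski2015, §1E (1.9)] -/
def setLeafFlux [Facts] (M a : ℝ) (ψ : region a (rPlus M a) → ℝ) (τ : ℝ) (A : Set E3) : ℝ≥0∞ :=
  ∫⁻ y in A, leafFluxDensity M a 0 ψ τ y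

/-- The energy in a volume is monotone in the volume. Sbierski 2015, §1E. [folklore] -/
theorem setLeafFlux_mono [Facts] (M a : ℝ) (ψ : region a (rPlus M a) → ℝ) (τ : ℝ) {A B : Set E3}
    (h : A ⊆ B) : setLeafFlux M a ψ τ A ≤ setLeafFlux M a ψ τ B :=
  lintegral_mono_set h

/-- The energy in the whole slice is the total flux `Kerr.leafFlux M a 0`. Sbierski 2015, §1E.
[folklore] -/
@[simp]
theorem setLeafFlux_univ [Facts] (M a : ℝ) (ψ : region a (rPlus M a) → ℝ) (τ : ℝ) :
    setLeafFlux M a ψ τ univ = leafFlux M a 0 ψ τ := by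
  simp [setLeafFlux, leafFlux, Measure.restrict_univ]

/-- The zero field has no energy in any volume (`T[0] = 0`, `Kerr.leafFlux_zero`). Sbierski 2015,
§1E. [folklore] -/
@[simp]
theorem setLeafFlux_zero_fun [Facts] (M a : ℝ) (τ : ℝ) (A : Set E3) :
    setLeafFlux M a (fun _ ↦ 0) τ A = 0 :=
  le_antisymm ((setLeafFlux_mono M a _ τ (subset_univ A)).trans
    (by rw [setLeafFlux_univ, leafFlux_zero])) bot_le

/-- The energy in the closed coordinate ball is `Kerr.localLeafFlux` at height `0`. Sbierski 2015,
§1E; DRSR arXiv:1402.7034, §3.3. [folklore] -/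
theorem setLeafFlux_closedBall [Facts] (M a : ℝ) (ψ : region a (rPlus M a) → ℝ) (τ R : ℝ) :
    setLeafFlux M a ψ τ (Metric.closedBall 0 R) = localLeafFlux M a 0 ψ τ R := rfl

/-- The **time-`τ` section** of a subset `𝒩` of the exterior chart: the set of spatial coordinates
`y` with `(τ, y) ∈ 𝒩`, i.e. `𝒩 ∩ Σ_τ` read in the coordinates `y` of the slice `Σ_τ = {t* = τ}`.
Sbierski, Anal. PDE 8 (2015), Thm. 5.1 (the sets `𝒩 ∩ Σ_τ`). [cite: Sbierski2015, Thm. 5.1] -/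
def timeSection (M a : ℝ) (𝒩 : Set (region a (rPlus M a))) (τ : ℝ) : Set E3 :=
  {y | ∃ h : E4.ofTimeSpace τ y ∈ region a (rPlus M a), (⟨E4.ofTimeSpace τ y, h⟩ : region a
    (rPlus M a)) ∈ 𝒩}

/-- Membership in the time section. [folklore] -/
theorem mem_timeSection {M a : ℝ} {𝒩 : Set (region a (rPlus M a))} {τ : ℝ} {y : E3} :
    y ∈ timeSection M a 𝒩 τ ↔ ∃ h : E4.ofTimeSpace τ y ∈ region a (rPlus M a),
      (⟨E4.ofTimeSpace τ y, h⟩ : region a (rPlus M a)) ∈ 𝒩 := Iff.rfl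

/-- The time section is monotone in the set. [folklore] -/
theorem timeSection_mono {M a : ℝ} {𝒩 𝒩' : Set (region a (rPlus M a))} (h : 𝒩 ⊆ 𝒩') (τ : ℝ) :
    timeSection M a 𝒩 τ ⊆ timeSection M a 𝒩' τ :=
  fun _ ⟨hy, hmem⟩ ↦ ⟨hy, h hmem⟩

end Kerr

/-! ### The trapped null geodesic of §7A (named fact, proved in `KerrPhotonOrbit.lean`) -/

/-- **The trapped null geodesics of Kerr with `N`-energy bounded away from `0` and `∞`** (named
fact). Sbierski, Anal. PDE 8 (2015), §7A (pp. 1412–1414): in the domain of outer communications of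
Kerr, `0 ≤ a ≤ m`, `m ≠ 0`, with `t* = v₊ − r` and `N = −(dt*)♯`, "there are trapped null geodesics
[…] whose energy stays bounded away from zero and infinity" — a trapped null geodesic being "a
future, complete, affinely parametrised null geodesic `γ : [0, ∞) → M`" which "does not escape to
infinity" — namely the null geodesics `γ_{r₀}` "trapped on the hypersurface `{r = r₀}` with
`r₀ ∈ [r_δ, r_ρ]`", `r_δ, r_ρ` the roots `≥ r₊` of `r(r − 3m)² − 4a²m` (so `r₀(r₀ − 3m)² ≤ 4a²m`),
whose `N`-energy "`−(N, γ̇) = (dt + dr* − dr)(γ̇) = ṫ`" is "bounded away from zero and infinity"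
(the geodesic flow of Kerr: O'Neill 1995, Ch. 4; Chandrasekhar, §63(c)). **Vendored form:** for
`0 < M`, `0 ≤ a ≤ M` there are `r₀ > r₊` with `r₀(r₀ − 3M)² ≤ 4a²M`, reals `0 < e₁ ≤ e₂` and a
geodesic `γ : ℝ → Kerr.exterior M a` of the Levi-Civita connection of `Kerr.smoothMetric M a r₊`
with null velocity, of constant Kerr–Schild radius `r(γ s) = r₀`, with `t*(γ 0) = 0`,
`e₁ ≤ γ̇⁰(s) ≤ e₂` for all `s` (so future-directed: `g(V, γ̇) = −γ̇⁰ < 0`), `t* ∘ γ` continuous,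
strictly increasing and tending to `+∞` (it crosses every leaf `Σ_τ`, `τ ≥ 0`: `τ* = ∞`). The
strict extremal case `r₀ = r_δ = r₊ = m` of the printed interval is excluded by `r₀ > r₊`
(take `r₀ = r_ρ`); the geodesic is asserted on all of `ℝ` (module docstring, "Rendering
choices"). Proved in `KerrPhotonOrbit.lean` by the retrograde equatorial circular photon orbit
(`Sbierski2015_kerr_trappedNullGeodesic_holds`).
[cite: Sbierski2015, §7A (pp. 1412–1414); O'Neill 1995 Ch. 4] -/
def Sbierski2015_kerr_trappedNullGeodesic : Prop :=
  ∀ [Kerr.Facts] [Kerr.SliceFacts] (M a : ℝ), 0 < M → 0 ≤ a → a ≤ M →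
    ∃ (r₀ e₁ e₂ : ℝ) (γ : ℝ → Kerr.exterior M a),
      Kerr.rPlus M a < r₀ ∧ r₀ * (r₀ - 3 * M) ^ 2 ≤ 4 * a ^ 2 * M ∧ 0 < e₁ ∧ e₁ ≤ e₂ ∧
      IsGeodesic (Kerr.smoothMetric M a (Kerr.rPlus M a)).leviCivita γ ∧
      (∀ s, (Kerr.smoothMetric M a (Kerr.rPlus M a)).IsNull (velocity 𝓘(ℝ, E4) γ s)) ∧
      (∀ s, Kerr.radius a (γ s : E4) = r₀) ∧
      (γ 0 : E4) 0 = 0 ∧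
      (∀ s, e₁ ≤ E4.time (velocity 𝓘(ℝ, E4) γ s) ∧ E4.time (velocity 𝓘(ℝ, E4) γ s) ≤ e₂) ∧
      Continuous (fun s ↦ (γ s : E4) 0) ∧
      StrictMono (fun s ↦ (γ s : E4) 0) ∧
      Tendsto (fun s ↦ (γ s : E4) 0) atTop atTop

end Literature.Geometry.Lorentzian

end
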